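import Mathlib
import HarnessLib
import HarnessLib.Audit
import Summits.NavierStokesRegularity.Statement
import Literature.Analysis.FluidPDE.ClassicalSolution
import Literature.Analysis.FluidPDE.LerayHopf
import Literature.Analysis.FluidPDE.NSWave0
import Literature.Analysis.FluidPDE.SuitableWeak
import Literature.Analysis.FluidPDE.Vorticity
import Summits.NavierStokesRegularity.NavierStokesRegularity.Theorems.AdiabaticEddyClayUniqueness

/-!
Route: MergerLadder

# Route MergerLadder — NavierStokesRegularity, NEGATIVE side (Type-II blow-up in the Euler window by
a MERGER LADDER; event renormalisation)
Card realised: NavierStokesRegularity/NavierStokesRegularity/merger-ladder-event-renormalisation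
("Kelvin's third branch: circulation doubling by vortex merger is the only legal road to Type II;
its energy affordability IS the Euler window").

## Thesis X ("it suffices to show X")
X (NS WINDOW BLOW-UP): for some ν > 0 there is a finite-energy (Leray–Hopf) classical solution of
unforced NS on ℝ³×[0,T) from a rapidly decaying smooth datum, with NO classical extension past T,
whose velocity blows up at a TWO-SIDED POWER RATE IN THE EULER WINDOW:
  c (T−t)^{−a} ≤ ‖u(t)‖_∞ ≤ C (T−t)^{−a}  for t ↑ T,  with  a ∈ (1/2, 3/5]   (Type II: a > 1/2 =
Leray's exponent).
The exponent is the fingerprint of the mechanism: a merger ladder with spatial contraction s per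
generation and circulation DOUBLING per generation (velocity factor 2s, vorticity factor 2s²,
generation time factor 1/(2s²)) has a = log(2s)/log(2s²) = α/(1+α), α = 1 + log 2/log s; energy
affordability of the continuing branch (2s)²s⁻³ ≤ 1 ⇔ s ≥ 4 ⇔ a ≤ 3/5 ⇔ α ≤ 3/2 — the Chae–Shvydkoy
window endpoint.
Lean (elaborates; Sketch.lean rc 0; decl `Target`):
 ∃ ν>0, ∃ T>0, ∃ u p, IsMaximalSmoothSolution ν 0 u p T ∧ IsLerayHopfOn T ν 0 (u 0) u ∧
HasRapidSpatialDecay (u 0) ∧ ∃ a c C t₁, 1/2 < a ∧ a ≤ 3/5 ∧ 0 < c ∧ 0 ≤ t₁ ∧ t₁ < T ∧ ∀ t ∈ Ico t₁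
T, (∀ x, ‖u t x‖ ≤ C (T−t)^(−a)) ∧ (∃ x, c (T−t)^(−a) ≤ ‖u t x‖)
(all constants `Literature.Analysis.FluidPDE.*`; X projects verbatim onto X5a = Blowup.BlowupExists,
stmt-NavierStokesRegularity-0152, and refutes TypeILiouville.TypeIliouvilleNoTypeII, stmt-0056 —
support item TargetRefutesNoTypeII).

## Assembly X → ¬NavierStokesRegularity
EulerWindowLadderBlowup → ViscousLadderBridge → ClayUniqueness (X5b, stmt-0153 verbatim, shared with
Blowup/CertifiedBlowup/DssFarFieldSlaving) → ¬NavierStokesRegularity.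
PROVED in Sketch.lean (3 lines) from the accepted glue `Literature.NS.blowup_assembly` ((X5a ∧ X5b)
→ ¬A, stmt-0151): the bridge applied to the Euler crux gives X, X projects to X5a.

## Two-layer plan (D-0019)
Layer 1 (cruxes, typed at open): #2 EulerWindowLadderBlowup — the same window blow-up for EULER (ν =
0: IsMaximalSmoothSolution 0 0 u p T, rapidly decaying datum, two-sided rate a ∈ (1/2,3/5]); this is
what the card's generation-map fixed point X* and its stable manifold deliver. #3
ViscousLadderBridge — (Euler window ladder blow-up) → X: robustness of the ladder under viscosity,
whose renormalised strength ν/Γ_n = ν 2^{−n}/Γ₀ is summable along the ladder. #4 (informal, added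
after open) GenerationMapFixedPoint — X_A of the card: the Euler generation map 𝓡_∞ (one
merge–collide–stretch event followed by renormalisation by scale 1/s, amplitude 2s, rigid motion)
has a HYPERBOLIC fixed point with s ≥ 4 on a section Σ of normalised pre-merger configurations;
definition request `EulerGenerationMap`. When the notion lands, #2 splits (glued) into (fixed point)
+ (stable manifold ∋ rapidly decaying data: far-field slaving) and #3 is restated over it.
Layer 2 (later): pace inequality for strained 3-D co-rotating merger vs. generation budget; daughter
identification for one finite-time Euler evolution; far-field slaving/truncation (shared theme with
DssFarFieldSlaving); validated enclosure of ONE smooth finite-time Euler evolution (Lanford-style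
certification).
Supports filed now: ClayUniqueness (shared 0153); LineStretchingIdentity (the pointwise kernel of
the card's circulation ledger: |ω| ξ·∇u ξ = ω·∇(u·ξ) − |ω| u·(ξ·∇)ξ, provable today);
TargetRefutesNoTypeII (X → ¬stmt-0056, cross-route bookkeeping, provable today).

Rationale: WHY THIS LINE. Kelvin's theorem leaves an iterated vortex cascade three ways to set the circulation
of generation n+1: SPLIT (θ<1: local Reynolds number → 0, cascade dies — the observed elliptic/Crow
cascades, MckeownEtAl2020, arXiv:2102.11133), RELAY (θ=1: Leray scaling, Type-I DSS — Tsai's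
TypeIDSSLiouvilleConjecture territory, routes Blowup #5 / DssFarFieldSlaving) or MERGE (θ=2: two
co-rotating daughters fuse before the next event). This route is the MERGE branch — an inverse
cascade of circulation riding a forward cascade of scale — the only branch compatible with Type II,
and its arithmetic lands exactly on the independently derived Euler window: α = 1+log2/log s ∈
(1,3/2] ⇔ s ≥ 4 ⇔ the continuing branch can afford its energy (2s)²s⁻³ ≤ 1 (ChaeShvydkoy2013 Thm
3.1–3.2: profiles excluded for α ≤ N/p and α > N/2, window open; Shvydkoy2013: energy concentration
dimension vs L^rL^∞ growth; ChaeTsai2014 Thm 3.1–3.2: same window for DSS Euler). Method imported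
from dynamical systems with an explicit dictionary (Feigenbaum1978, Lanfordiii1982; Mailybaev2013
for RG readings of blow-up in shell models): unimodal map ↦ one merge–collide–stretch generation;
doubling operator ↦ renormalised generation map 𝓡_n = g∘Φ_τ (g: scale 1/s, amplitude 2s;
renormalised viscosity ν2^{−n} ⇒ 𝓡_n → 𝓡_∞ = Euler map); Feigenbaum fixed point ↦ X* = 𝓡_∞X*; δ ↦
unstable eigenvalues of D𝓡_∞(X*) = codimension of blow-up data; Lanford's proof ↦ validated
enclosure of ONE finite-time smooth Euler evolution plus a rescaling — a finite-time computation on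
smooth data, better conditioned than a profile equation with |y|⁻¹ tails (the template of
CertifiedBlowup it departs from). The event formulation represents what no similarity profile can:
violent intra-generation dynamics with self-similarity only stroboscopically, so
NRŠ/Tsai/Chae–Wolf/Chae–Shvydkoy/Chae–Tsai profile theorems are silent while the a-priori energy
window is met by construction. The typed spine is deliberately PDE-level (maximal classical
solutions + a two-sided rate), so that items elaborate today, dedupe with sibling routes, and
survive any exclusion theorem about PROFILES.
RANKED CRUXES. #2 EulerWindowLadderBlowup (typed): Euler, rapidly decaying smooth datum, finite
maximal lifespan, c(T−t)^{−a} ≤ ‖u‖_∞ ≤ C(T−t)^{−a}, a ∈ (1/2,3/5]. Why it might fail: no smooth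
finite-energy Euler blow-up on ℝ³ is known at all (Elgindi2021 needs C^{1,α}, ChenHou2025 a
boundary); the merge branch must win a PACE race — 2-D merger completes only after several pair
rotations, T_merge ≈ c b²/Γ with c = O(10) above the critical core ratio a/b ≈ 0.24
(MeunierLedizesLeweke2005), against a generation budget τ_n ≍ ℓ_n²/Γ_n — else the ladder degenerates
to RELAY (Type I) or SPLIT (death); cores may sheet before fusing. #3 ViscousLadderBridge (typed):
(Euler window ladder blow-up) → X. Why it might fail: as an implication between existentials it is
provable only by re-running the construction at ν > 0, i.e. it needs a finite-codimension
(hyperbolic) ladder; if every Euler window blow-up is infinitely unstable, or cross-diffusive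
annihilation at the first O(1)-Reynolds generations (bridges/threads, YaoHussain2020) derails the
orbit before the renormalised viscosity ν2^{−n} becomes negligible, the hypothesis can hold with the
conclusion false. #4 GenerationMapFixedPoint (informal until `EulerGenerationMap` is defined):
hyperbolic fixed point of 𝓡_∞ with s ≥ 4 — the card's X_A; cheapest test = the pace inequality on
the Rosenhead–Moore–Saffman filament model with cores or one DNS of a strained co-rotating pair.
KILL CRITERIA. TypeIliouvilleNoTypeII (stmt-0056) or any a-priori bound forcing a ≤ 1/2 for
finite-energy classical NS blow-up proved ⇒ X refuted, close `refuted:Target`. NoBlowup (stmt-0054)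
proved ⇒ moot. A theorem excluding finite-energy smooth Euler blow-up with sup-norm growth
(T−t)^{−a}, a ≤ 3/5 (e.g. an energy-concentration argument extending Shvydkoy2013 to the closed
endpoint and below) ⇒ #2 refuted ⇒ close unless #2 can be restated with a different window. Pace
inequality failing decisively on the filament model (c(b/ℓ)² > budget at every s ≥ 4) ⇒ retire #4
and close `exhausted` with the positive by-product 'pairwise merging cannot sustain the Euler
window' recorded. ClayUniqueness refuted with no replacement ⇒ shared fate with Blowup.
NOT DECOMPOSED. The section Σ, daughter identification, far-field slaving/truncation
(DssFarFieldSlaving's theme, here for an Euler event map), the validated integrator, and the split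
of #2 into (fixed point) + (stable manifold ∋ Schwartz data) — all wait for the definition
`EulerGenerationMap` and for #4's pace test. X5b is attacked in route Blowup (stmt-0722/0728), not
here.
NUMBERS. Per generation: Γ×2, ℓ×s⁻¹, U×2s, ω×2s², τ×(2s²)⁻¹, Re×2, branch energy ×4/s; a(s) =
log(2s)/log(2s²): a(4) = 3/5, a(∞) = 1/2; α = 1+log2/log s, γ = 1/(1+α) ∈ [2/5,1/2);
ChaeShvydkoy2013 exclusions: −1 < α ≤ N/p (v ∈ L^p∩C¹_loc, 3 ≤ p ≤ ∞) and α > N/2; Shvydkoy2013: u ∈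
L^rL^∞, r ≥ 5/3 ⇒ dim(energy concentration set) ≥ 3 − 2/(r−1), no atoms at r = 5/3 (a < 3/5 strictly
inside, a = 3/5 borderline); 2-D merger threshold a/b ≈ 0.24–0.3. Items at open: 7 typed (target,
assembly, 2 cruxes, 3 supports) + 1 informal crux + 1 definition request after open.
PRIOR-PROGRAMME NOTES: not read (plancard mode; nothing adopted from docs/m5/inspiration).

Novelty: NOVELTY (searched 2026-08-15, this session: `lit frontier NavierStokesRegularity --since 2022`, `lit
bridges NavierStokesRegularity --cross any`, `lit search --source zbmath` for "locally self-similar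
Euler blow-up energy", "discretely self-similar Euler", "merging of two co-rotating vortices
critical ratio"; `lit search --hybrid` (local vectors) for vortex merger / Euler window; `lit galaxy
search --star all` for "vortex merger cascade singularity", "iterated vortex reconnection" (0 rows)
and `--star pdf` "vortex merger" (engineering/geophysical hits only); `lit read` of arXiv:1201.6009
(pp.2–7), arXiv:1205.1544 (pp.2–5), arXiv:1304.7414 (pp.3–7); the card's own audited search
(BHP2016, McKeown 2018/2020, Ostilla-Mónico 2021, YaoHussain2020, Moffatt–Kimura, Rica,
Mailybaev2013); all 8 NS route files; negatives index (empty)).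
Nearest prior art: ChaeShvydkoy2013 (doi:10.1007/s00205-013-0630-z) and ChaeTsai2014
(doi:10.4310/mrl.2014.v21.n3.a2) — the window N/p < α ≤ N/2 as the UNEXCLUDED range for (discretely)
self-similar Euler collapse, with no mechanism proposed to populate it; Shvydkoy2013
(doi:10.1088/0951-7715/26/2/425) — energetics (concentration/drain, 'merger of two solutions' in the
sense of energy drain, not vortex merger); BrennerHormozPumir2016
(doi:10.1103/physrevfluids.1.084503) — iterated-instability cascade as a discrete generation map
with fixed scale factor and geometric times (RELAY/SPLIT-type circulation, non-singular
asymptotics); MckeownEtAl2020 — ellipt  [refs: 10.1007/s00205-013-0630-z, 10.4310/mrl.2014.v21.n3.a2, 10.1088/0951-7715/26/2/425, 10.1103/physrevfluids.1.084503, 10.1017/jfm.2020.58, 1201.6009, 1205.1544, 1304.7414, doi:10.1007/s00205-013-0630-z, doi:10.4310/mrl.2014.v21.n3.a2, doi:10.1088/0951-7715/26/2/425, doi:10.1103/physrevfluids.1.084503, doi:10.1017/jfm.2020.58, YaoHussain2020, Mailybaev2013, ChaeShvydkoy2013, ChaeTsai2014, Shvydkoy2013]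

Barriers (technique_class: blowup-construction event-renormalisation merger-cascade): technique_class: blowup-construction event-renormalisation merger-cascade
- Literature.Barriers.NavierStokesRegularity.LeraySelfSimilarBlowupExclusion (necas_ruzicka_sverak,
tsai_selfsimilar, tsai_selfsimilar_local_energy; and for Euler ChaeShvydkoy2013 Thm 3.1–3.2,
ChaeTsai2014 Thm 3.1–3.2): evaded by OBJECT and by EXPONENT — the witness is not an exactly (or
s-periodically) self-similar profile of any similarity equation (self-similarity holds only
stroboscopically across violent merger events, and the typed cruxes assert only a maximal classical
solution with a two-sided rate, no profile), and its exponent a ∈ (1/2,3/5] ⇔ α ∈ (1,3/2] sits in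
the range those theorems leave open (they kill α ≤ N/p with L^p profiles and α > N/2; at α = N/2
only L² profiles with power tails).
- Literature.Barriers.NavierStokesRegularity.CriticalNormBlowupNecessity (ess_endpoint,
seregin_L3_blowup, tao_L3_blowup_rate): MET, not evaded — a > 1/2 forces ‖u(t)‖_{L³} → ∞ (the
concentrating core has |u| ~ U_n on volume ~ ℓ_n³ with U_n³ℓ_n³ = (2s·s⁻¹)^{3n}U₀³ℓ₀³ = 8ⁿU₀³ℓ₀³ →
∞); L³-bounded ansätze are void and this route has none.
- Literature.Barriers.NavierStokesRegularity.SingularSetDimensionBound (ckn_partial_regularity): MET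
— the event sequence accumulates at a single space-time point (x₀,T); no curve or sheet of
singularities is posited.
- Literature.Barriers.NavierStokesRegularity.AxisymmetricTypeIExclusion (knss_no_axisymmetric_typeI,
SereginSverak2009): not engaged — the ladder is non-axisy

Novelty grade: new-combination — ROUTE REVIEW (refuter d9e80d69, 2026-08-15; 2nd pass after planner-retriage 11:09Z and f1c63249 11:17Z). GRADE new-combination: merge-branch ladder (circulation doubling) + Feigenbaum/Lanford event renormalisation + Chae–Shvydkoy/Shvydkoy energy window; nearest uncited neighbour = Childress's energy (refuter refuter-rreview-route-RiemannHypothesis--d9e80d69-0, 2026-08-15T13:59:22Z; prior: ChaeShvydkoy2013 doi:10.1007/s00205-013-0630-z; ChaeTsai2014 doi:10.4310/mrl.2014.v21.n3.a2 (unexcluded window N/p<α≤N/2), Shvydkoy2013 doi:10.1088/0951-7715/26/2/425 (energetics of locally self-similar blow-up), BrennerHormozPumir2016 doi:10.1103/physrevfluids.1.084503 (iterated-instability cascade as a generation map), Childress Physica D 237 (2008) doi:10.1016/j.physd.2008.02.028; Childress–Gil)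

sub-problem: NavierStokesRegularity · status: done · opened planner-plancard-NavierStokesRegularity-Navie-5363570a-0 2026-08-15T10:49:11Z · rev 3 · ledger route-NavierStokesRegularity-MergerLadder
GENERATED by the gate from the ledger (D-0016/17). Provers cite these decls: `theorem foo : Summit.NavierStokesRegularity.NavierStokesRegularity.Theses.MergerLadder.<Decl> := …` in Summits/NavierStokesRegularity/NavierStokesRegularity/Theorems/<Name>.lean.
-/

namespace Summit.NavierStokesRegularity.NavierStokesRegularity.Theses.MergerLadder

open scoped BigOperators Topology Manifold Classical MeasureTheory ProbabilityTheory Matrix InnerProductSpace ComplexConjugate ContinuousMap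
open Filter Set Function TopologicalSpace MeasureTheory

attribute [summit_statement] _root_.NavierStokesRegularity

open Literature.NS

/-- item stmt-NavierStokesRegularity-1052 · target · rank 0 · open · by planner
why it might fail: False if NS is globally regular (NoBlowup stmt-0054) or every finite-energy classical blow-up is Type I / has no two-sided power law (NoTypeII stmt-0056; KNSS2009, SereginSverak2009 force Type II only under axisymmetry); Type-II evidence is numerical (arXiv:2107.06509) or for averaged NS (Tao2016).
sources: KochNadirashviliSereginSverak2009, SereginSverak2009, Seregin2012, Hou2022PotentiallySingularNS, Tao2016AveragedNS, ChaeShvydkoy2013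
[target] X: for some ν>0 a finite-energy (Leray–Hopf) classical NS solution from a rapidly decaying
smooth datum has finite maximal lifespan T and blows up at a TWO-SIDED power rate in the Euler
window, c(T−t)^{−a} ≤ ‖u(t)‖_∞ ≤ C(T−t)^{−a}, a ∈ (1/2,3/5] (Type II since a>1/2). For a merger
ladder with contraction s and circulation doubling per generation a = log(2s)/log(2s²), and a ≤ 3/5
⇔ s ≥ 4 ⇔ energy affordability (2s)²s⁻³ ≤ 1 ⇔ Chae–Shvydkoy endpoint α = a/(1−a) ≤ 3/2. Projects
verbatim onto X5a = Blowup.BlowupExists (stmt-NavierStokesRegularity-0152); negates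
TypeILiouville.TypeIliouvilleNoTypeII (stmt-0056) via support TargetRefutesNoTypeII. [sources:
ChaeShvydkoy2013, Shvydkoy2013, Tao2016AveragedNS, arXiv:2107.06509, KNSS2009] -/
@[route_item "route-NavierStokesRegularity-MergerLadder"]
def Target : Prop :=
  ∃ ν : ℝ, 0 < ν ∧ ∃ T : ℝ, 0 < T ∧ ∃ (u : ℝ → EuclideanSpace ℝ (Fin 3) → EuclideanSpace ℝ (Fin 3)) (p : ℝ → EuclideanSpace ℝ (Fin 3) → ℝ), Literature.Analysis.FluidPDE.IsMaximalSmoothSolution ν 0 u p T ∧ Literature.Analysis.FluidPDE.IsLerayHopfOn T ν 0 (u 0) u ∧ Literature.Analysis.FluidPDE.HasRapidSpatialDecay (u 0) ∧ ∃ (a c C t₁ : ℝ), 1 / 2 < a ∧ a ≤ 3 / 5 ∧ 0 < c ∧ 0 ≤ t₁ ∧ t₁ < T ∧ ∀ t ∈ Set.Ico t₁ T, (∀ x, ‖u t x‖ ≤ C * (T - t) ^ (-a)) ∧ (∃ x, c * (T - t) ^ (-a) ≤ ‖u t x‖)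

/-- item stmt-NavierStokesRegularity-1055 · crux · rank 3 · open · by planner
why it might fail: As typed its hypothesis EulerWindowLadderBlowup is vacuous, so the item is equivalent to Target: false if NS is globally regular (stmt-0054) or all blow-up is Type I (stmt-0056). Even repaired, Euler blow-up => NS blow-up is open; only Euler-smooth => NS-smooth (small nu) is known: Constantin1986.
sources: Constantin1986, ConstantinFoias1988, MajdaBertozzi2002, YaoHussain2020, Tao2016AveragedNS, Lanfordiii1982
[crux] VISCOUS BRIDGE: (EulerWindowLadderBlowup, verbatim) → (Target, verbatim). Content = the
card's robustness/transfer crux: along the ladder the renormalised viscosity is ν/Γ_n = (ν/Γ₀)2^{−n}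
— summable — so the generation maps 𝓡_n (NS at Reynolds number Γ_n/ν) converge to the Euler map 𝓡_∞
and a uniformly hyperbolic fixed point keeps a stable manifold under the summable non-autonomous
perturbation 𝓡_n − 𝓡_∞ (standard for hyperbolic maps; derivative bounds of 𝓡_n must not degenerate
as the effective viscosity vanishes, i.e. the Euler event itself is smooth within one generation);
starting the ladder at large Γ₀/ν makes the first generations near-Euler. Output at ν>0: maximal
classical LH solution from a rapidly decaying datum with the same two-sided rate (Type II). Honest
caveat: as an implication between existentials it can only be proved by re-running the construction
with ν>0; to be RESTATED over `EulerGenerationMap`/hyperbolicity once that notion is defined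
(set-signature). [sources: YaoHussain2020, Lanfordiii1982, Feigenbaum1978, Mailybaev2013,
Tao2016AveragedNS] -/
@[route_item "route-NavierStokesRegularity-MergerLadder"]
def ViscousLadderBridge : Prop :=
  (∃ T : ℝ, 0 < T ∧ ∃ (u : ℝ → EuclideanSpace ℝ (Fin 3) → EuclideanSpace ℝ (Fin 3)) (p : ℝ → EuclideanSpace ℝ (Fin 3) → ℝ), Literature.Analysis.FluidPDE.IsMaximalSmoothSolution 0 0 u p T ∧ Literature.Analysis.FluidPDE.HasRapidSpatialDecay (u 0) ∧ ∃ (a c C t₁ : ℝ), 1 / 2 < a ∧ a ≤ 3 / 5 ∧ 0 < c ∧ 0 ≤ t₁ ∧ t₁ < T ∧ ∀ t ∈ Set.Ico t₁ T, (∀ x, ‖u t x‖ ≤ C * (T - t) ^ (-a)) ∧ (∃ x, c * (T - t) ^ (-a) ≤ ‖u t x‖)) → (∃ ν : ℝ, 0 < ν ∧ ∃ T : ℝ, 0 < T ∧ ∃ (u : ℝ → EuclideanSpace ℝ (Fin 3) → EuclideanSpace ℝ (Fin 3)) (p : ℝ → EuclideanSpace ℝ (Fin 3) → ℝ), Literature.Analysis.FluidPDE.IsMaximalSmoothSolution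 ν 0 u p T ∧ Literature.Analysis.FluidPDE.IsLerayHopfOn T ν 0 (u 0) u ∧ Literature.Analysis.FluidPDE.HasRapidSpatialDecay (u 0) ∧ ∃ (a c C t₁ : ℝ), 1 / 2 < a ∧ a ≤ 3 / 5 ∧ 0 < c ∧ 0 ≤ t₁ ∧ t₁ < T ∧ ∀ t ∈ Set.Ico t₁ T, (∀ x, ‖u t x‖ ≤ C * (T - t) ^ (-a)) ∧ (∃ x, c * (T - t) ^ (-a) ≤ ‖u t x‖))

-- item stmt-NavierStokesRegularity-1074 · crux · rank 4 · open · by planner — informal only, no Lean statement yet: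
--   [crux] X_A of the card (informal until the notion `EulerGenerationMap` is defined; definition
--   request filed): the EULER GENERATION MAP 𝓡_∞ := g ∘ Φ_τ — one merge–collide–stretch event of smooth
--   finite-energy Euler dynamics (two co-rotating daughter pairs of generation n fuse into the carrier
--   of generation n+1 against an antiparallel partner that supplies the stretch), read on a Poincaré
--   section Σ of normalised pre-merger configurations and renormalised by the similarity g (scale 1/s,
--   velocity amplitude 2s, rigid motion) — has a HYPERBOLIC FIXED POINT X* = 𝓡_∞X* with s ≥ 4 (energy
--   affordability

/-- item stmt-NavierStokesRegularity-1054 · support · rank 2 · open · by planner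
why it might fail: No smooth finite-energy Euler blow-up on R^3 is known (Elgindi2021: C^{1,a} data; ChenHou2025: boundary). The MERGE branch must win a pace race: 2-D merger needs T~c b^2/Gamma, c=O(10), a/b>0.24 (MeunierLedizesLeweke2005) vs budget l_n^2/Gamma_n; losing it gives relay (Type I) or split (death).
sources: BealeKatoMajda1984, ChaeShvydkoy2013, Elgindi2021, ChenHou2025, CordobaMartinezZoroa2023, CordobaFefferman2001
[crux] EULER window ladder blow-up: a classical Euler solution (ν = 0) on ℝ³×[0,T) from a rapidly
decaying smooth datum with NO classical Euler extension past T and the two-sided rate c(T−t)^{−a} ≤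
‖u(t)‖_∞ ≤ C(T−t)^{−a}, a ∈ (1/2,3/5] (⇔ locally-self-similar exponent α = a/(1−a) ∈ (1,3/2], the
range ChaeShvydkoy2013 Thm 3.2 / ChaeTsai2014 Thm 3.1–3.2 leave open; a ≤ 3/5 is forced by energy
conservation for a concentrating core, U²ℓ³ ~ (T−t)^{3−5a}). This is what the card's method
delivers: a hyperbolic fixed point X* of the Euler generation map 𝓡_∞ (one merge–collide–stretch
event renormalised by scale 1/s, amplitude 2s, rigid motion; crux GenerationMapFixedPoint) whose
stable manifold contains rapidly decaying smooth data (far-field slaving), iterated: Γ×2, ℓ/s, U×2s,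
ω×2s², τ/(2s²) per generation, T = Στ_n < ∞, a = log(2s)/log(2s²). Deliberately profile-free (no DSS
asserted) so that profile-exclusion theorems do not bear on it; BKM-consistent (‖ω‖_∞ ~ (T−t)^{−1}).
Layer-2 split foreseen: (fixed point) + (stable manifold ∋ Schwartz data) glued. [sources:
ChaeShvydkoy2013, ChaeTsai2014, Shvydkoy2013, Elgindi2021, ChenHou2025, MeunierLedizesLeweke2005,
BrennerHormozPumir2016, Mcke -/
@[route_item "route-NavierStokesRegularity-MergerLadder"]
def EulerWindowLadderBlowup : Prop :=
  ∃ T : ℝ, 0 < T ∧ ∃ (u : ℝ → EuclideanSpace ℝ (Fin 3) → EuclideanSpace ℝ (Fin 3)) (p : ℝ → EuclideanSpace ℝ (Fin 3) → ℝ), Literature.Analysis.FluidPDE.IsMaximalSmoothSolution 0 0 u p T ∧ Literature.Analysis.FluidPDE.HasRapidSpatialDecay (u 0) ∧ ∃ (a c C t₁ : ℝ), 1 / 2 < a ∧ a ≤ 3 / 5 ∧ 0 < c ∧ 0 ≤ t₁ ∧ t₁ < T ∧ ∀ t ∈ Set.Ico t₁ T, (∀ x, ‖u t x‖ ≤ C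 * (T - t) ^ (-a)) ∧ (∃ x, c * (T - t) ^ (-a) ≤ ‖u t x‖)

/-- item stmt-NavierStokesRegularity-0153 · support · rank 9 · closed · proved by Summit.NavierStokesRegularity.NavierStokesRegularity.Theorems.adiabaticEddy_clayUniqueness_proof @ bd26efe366a2 (prover) · by planner
sources: Fefferman2000, Prodi1959, Serrin1963
Fefferman's class (A) = jointly C^∞ on ℝ³×[0,∞) + sup_t ∫|u|² < ∞; no energy inequality, no decay of
∇u, no integrability in LPS scales is assumed. Claim: such (u,p) coincides on [0,T) with any
Leray–Hopf classical solution v from the same rapidly decaying datum. Expected route: smoothness +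
bounded energy ⇒ u is a distributional solution with locally finite dissipation?? (NOT automatic:
∫∫|∇u|² may be infinite) — this is exactly the delicate point; alternatives: Liouville-type control
of the pressure (p harmonic part must be affine ⇒ excluded by bounded energy), then local energy
inequality, then weak–strong uniqueness (Prodi 1959, Serrin 1963) against v which is in every LPS
class on compacts of [0,T). [sources: Prodi1959, Serrin1963, Fefferman2000, LemarieRieusset2002,
RobinsonRodrigoSadowski2016] -/
@[route_item "route-NavierStokesRegularity-MergerLadder"]
def ClayUniqueness : Prop :=
  ∀ ν : ℝ, 0 < ν → ∀ (u₀ : EuclideanSpace ℝ (Fin 3) → EuclideanSpace ℝ (Fin 3)), Literature.Analysis.FluidPDE.HasRapidSpatialDecay u₀ → ∀ (u v : ℝ → EuclideanSpace ℝ (Fin 3) → EuclideanSpace ℝ (Fin 3)) (p q : ℝ → EuclideanSpace ℝ (Fin 3) → ℝ) (T : ℝ), 0 < T → Literature.Analysis.FluidPDE.IsSmoothOnHalfSpace u → Literature.Analysis.FluidPDE.IsSmoothOnHalfSpace p → Literature.Analysis.FluidPDE.IsNavierStokesSolution ν 0 u₀ u p → Literature.Analysis.FluidPDE.HasBoundedEnergy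 u → Literature.Analysis.FluidPDE.IsClassicalNSSolutionOn (Set.Ico 0 T) ν 0 v q → Literature.Analysis.FluidPDE.IsLerayHopfOn T ν 0 u₀ v → v 0 = u₀ → ∀ t ∈ Set.Ico 0 T, u t = v t

/-- `ClayUniqueness` holds: proved by `Summit.NavierStokesRegularity.NavierStokesRegularity.Theorems.adiabaticEddy_clayUniqueness_proof` @ bd26efe366a2. -/
theorem ClayUniqueness_holds : ClayUniqueness := _root_.Summit.NavierStokesRegularity.NavierStokesRegularity.Theorems.adiabaticEddy_clayUniqueness_proof

/-- item stmt-NavierStokesRegularity-1056 · support · rank 9 · closed · proved by Summit.NavierStokesRegularity.NavierStokesRegularity.Theorems.mergerLadder_lineStretchingIdentity_proof (prover) · by planner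
sources: ConstantinFefferman1993, ChaeTsai2014, MajdaBertozzi2002
[support] The pointwise kernel of the card's circulation ledger (exact, elementary, provable today):
for u ∈ C²(ℝ³;ℝ³), ω = curl u, ξ = ω/|ω| (Literature.Analysis.FluidPDE.vorticityDirection, junk 0
where ω = 0) and any x with ω(x) ≠ 0: |ω| ⟪ξ, Du ξ⟫ = D(u·ξ)(x)[ω] − |ω| ⟪u, Dξ ξ⟫, i.e. |ω|σ =
ω·∇(u·ξ) − |ω| u·κ with stretching rate σ = ξ·Sξ and curvature vector κ = (ξ·∇)ξ. Proof: product
rule for y ↦ ⟪u y, ξ y⟫ in the direction ω x = |ω x| ξ x (ξ is differentiable at x since ω is C¹ and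
ω x ≠ 0). Integrated over a ball with div ω = 0 it gives the card's boundary-flux form d/dt∫_B|ω|
(stretching of straight lines is a pure flux; circulation-per-ball rises only by transport across
lines or by bending) — the audit ledger for 'θ = 2 per merger'. Same bookkeeping as α̂ = ξ·∇V·ξ in
ChaeTsai2014 Thm 2.2. [sources: ConstantinFefferman1993, ChaeTsai2014, MajdaBertozzi2002] -/
@[route_item "route-NavierStokesRegularity-MergerLadder"]
def LineStretchingIdentity : Prop :=
  ∀ (u : EuclideanSpace ℝ (Fin 3) → EuclideanSpace ℝ (Fin 3)), ContDiff ℝ 2 u → ∀ x : EuclideanSpace ℝ (Fin 3), Literature.Analysis.FluidPDE.curl u x ≠ 0 → ‖Literature.Analysis.FluidPDE.curl u x‖ * (inner ℝ (Literature.Analysis.FluidPDE.vorticityDirection (Literature.Analysis.FluidPDE.curl u) x) (fderiv ℝ u x (Literature.Analysis.FluidPDE.vorticityDirection (Literature.Analysis.FluidPDE.curl u) x))) = fderiv ℝ (fun y => inner ℝ (u y) (Literature.Analysis.FluidPDE.vorticityDirection (Literature.Analysis.FluidPDE.curl u) y)) x (Literature.Analysis.FluidPDE.curl u x) - ‖Literature.Analysis.FluidPDE.curl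 u x‖ * (inner ℝ (u x) (fderiv ℝ (Literature.Analysis.FluidPDE.vorticityDirection (Literature.Analysis.FluidPDE.curl u)) x (Literature.Analysis.FluidPDE.vorticityDirection (Literature.Analysis.FluidPDE.curl u) x)))

-- `LineStretchingIdentity` holds: proved by `Summit.NavierStokesRegularity.NavierStokesRegularity.Theorems.mergerLadder_lineStretchingIdentity_proof` (its module imports this route file, so no `_holds` link can be stated here).

/-- item stmt-NavierStokesRegularity-1057 · support · rank 9 · closed · proved by Summit.NavierStokesRegularity.NavierStokesRegularity.Theorems.mergerLadder_targetRefutesNoTypeII_proof (prover) · by planner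
sources: Leray1934, Seregin2012, KochNadirashviliSereginSverak2009
[support] Cross-route bookkeeping, provable today (~40 lines of real analysis): X (Target, verbatim)
→ ¬NoTypeII, where NoTypeII is verbatim TypeILiouville.TypeIliouvilleNoTypeII
(stmt-NavierStokesRegularity-0056: every maximal LH classical solution from a rapidly decaying datum
is Type I, ‖u(t,x)‖ ≤ C/√(T−t) eventually). Proof: the witness of X has c(T−t)^{−a} ≤ ‖u(t,x_t)‖
with a > 1/2 on [t₁,T); NoTypeII gives ∀ᶠ t in 𝓝[<] T, ∀ x, ‖u t x‖ ≤ C'/√(T−t)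
(Literature.Analysis.FluidPDE.IsTypeIBlowup); hence (T−t)^{1/2−a} ≤ C'/c for t near T, contradicting
a > 1/2 (Real.rpow → ∞). Records in Lean that this route and TypeILiouville #2 are each other's
refutation targets. [sources: Leray1934, Seregin2012, KNSS2009] -/
@[route_item "route-NavierStokesRegularity-MergerLadder"]
def TargetRefutesNoTypeII : Prop :=
  (∃ ν : ℝ, 0 < ν ∧ ∃ T : ℝ, 0 < T ∧ ∃ (u : ℝ → EuclideanSpace ℝ (Fin 3) → EuclideanSpace ℝ (Fin 3)) (p : ℝ → EuclideanSpace ℝ (Fin 3) → ℝ), Literature.Analysis.FluidPDE.IsMaximalSmoothSolution ν 0 u p T ∧ Literature.Analysis.FluidPDE.IsLerayHopfOn T ν 0 (u 0) u ∧ Literature.Analysis.FluidPDE.HasRapidSpatialDecay (u 0) ∧ ∃ (a c C t₁ : ℝ), 1 / 2 < a ∧ a ≤ 3 / 5 ∧ 0 < c ∧ 0 ≤ t₁ ∧ t₁ < T ∧ ∀ t ∈ Set.Ico t₁ T, (∀ x, ‖u t x‖ ≤ C * (T - t) ^ (-a)) ∧ (∃ x, c * (T - t) ^ (-a) ≤ ‖u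 t x‖)) → ¬ (∀ (ν T : ℝ), 0 < ν → 0 < T → ∀ (u : ℝ → EuclideanSpace ℝ (Fin 3) → EuclideanSpace ℝ (Fin 3)) (p : ℝ → EuclideanSpace ℝ (Fin 3) → ℝ), Literature.Analysis.FluidPDE.IsMaximalSmoothSolution ν 0 u p T → Literature.Analysis.FluidPDE.IsLerayHopfOn T ν 0 (u 0) u → Literature.Analysis.FluidPDE.HasRapidSpatialDecay (u 0) → Literature.Analysis.FluidPDE.IsTypeIBlowup u T)

-- `TargetRefutesNoTypeII` holds: proved by `Summit.NavierStokesRegularity.NavierStokesRegularity.Theorems.mergerLadder_targetRefutesNoTypeII_proof` (its module imports this route file, so no `_holds` link can be stated here).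

/-- item stmt-NavierStokesRegularity-1053 · assembly · rank 1 · closed · proved by Summit.NavierStokesRegularity.NavierStokesRegularity.Theorems.mergerLadder_assembly_proof (prover) · by planner
sources: Fefferman2000, BealeKatoMajda1984
[assembly] Pure logic, PROVED in the planner's Sketch.lean (3 lines): apply ViscousLadderBridge to
EulerWindowLadderBlowup to get X (= Target), project X onto X5a (drop the rate conjunct), and feed
⟨X5a, ClayUniqueness⟩ to the accepted glue Literature.NS.blowup_assembly ((X5a ∧ X5b) →
¬NavierStokesRegularity, stmt-NavierStokesRegularity-0151, Theorems/BlowupAssembly.lean). Closes the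
moment a prover copies it. [sources: Fefferman2000, BealeKatoMajda1984] -/
@[route_item "route-NavierStokesRegularity-MergerLadder"]
def Assembly : Prop :=
  EulerWindowLadderBlowup → ViscousLadderBridge → ClayUniqueness → ¬ NavierStokesRegularity

-- `Assembly` holds: proved by `Summit.NavierStokesRegularity.NavierStokesRegularity.Theorems.mergerLadder_assembly_proof` (its module imports this route file, so no `_holds` link can be stated here).

end Summit.NavierStokesRegularity.NavierStokesRegularity.Theses.MergerLadder
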